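import Mathlib
import HarnessLib
import Summits.HubbardSuperconductivity.HubbardSuperconductivity.Theorems.KLProgrammeKLRegimeEnginePairLadderTransferCompose

/-!
# Route `KLProgramme` — crux K3, ENGINE child gen 8 (stmt-HubbardSuperconductivity-20437 `KLRegimeEngineV17F2`), stub (c) `stub_engine_step_values`,
# skeleton v2 class #5 (pair-transfer family): RE-PINNING the weight of a forward resummation relation — `kltc_repin_on`, `kltc_transfer_compose_fwd_on_repin`

Cell gate-hubbard-kl, seat hubbard-kl-k3c1-p1 (g9), technique «composed-map remainder propagation».

The re-export of a family member at the new scale (KLTC-INDEX-v6 §B step 4) is `kltc_transfer_compose_fwd_on` (p540411): it produces the member relation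
`Y ≈ F_{−b}(C₁)` with the COMPOSED weight `b = b′ + w − w₁` EXACTLY.  An export text that hides the transfer weight behind `∃` with a mass line cannot be
re-exported that way (the mass of `b′ + w − w₁` is only bounded by `mass(b′) + Σ|w − w₁|`, which drifts linearly in the scale index — KL STATUS k3c1-p1 16:16Z);
the cure is to PIN the weight to a model function `t⋆_n` whose mass/sign lines are model lemmas, and to pass from the composed weight to the pinned one.  This file
is that passage, as exact algebra plus ONE weighted-kernel perturbation:

* `kltc_repin_on` — on any truncation set `B`: from `(1 − diag u·C)M = 1`, `‖Y − C·M‖ ≤ R` on `B²`, `|C| ≤ m`, and a second real weight `v` with `Σ|u − v| ≤ δ`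
  (smallness `m·Σ|u| ≤ 1/3`, `m·Σ|v| ≤ 1/3`): a two-sided inverse `M′` of `1 − diag v·C` with `‖Y − C·M′‖ ≤ R + (9/4)m²·δ` on `B²` (`klcrs_weight_perturbation`,
  p457092; the given right inverse IS the Neumann inverse by uniqueness).  With `δ = 0` (`v = u` pointwise up to a proof of equality) it merely re-keys the weight.
* `kltc_transfer_compose_fwd_on_repin` — p540411 followed by re-pinning: the member relation at the new scale with ANY target weight `t` such that
  `Σ|t − (b′ + w − w₁)| ≤ δ`, defect `E_a + FT_{|w₁|}(E₁) + (9/4)m²δ`.  Under a pinned class-#5 text the caller takes `t := t⋆_n` and discharges `δ` from the model's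
  bubble identities (`δ = 0` for common lines; a gained `δ` if the towers' rungs are dressed differently from the transfer's lines).

Exact algebra over landed lemmas; nothing about the model's sizes is asserted.  0 kit.
-/

noncomputable section

namespace Summit.HubbardSuperconductivity.HubbardSuperconductivity.Theorems.KLRegimeSplit

set_option linter.dupNamespace false -- summit = problem name (single-conjunct summit), D-0017

open Finset Matrix
open Summit.HubbardSuperconductivity.HubbardSuperconductivity.Theorems.KLProgrammeCooperResummation

section Repin

variable {S : Type*} [Fintype S] [DecidableEq S] [Nonempty S]

/-- **Re-pinning the weight of a forward resummation relation.**  `(1 − diag u·C)·M = 1`, `‖Y − C·M‖ ≤ R` on `B²`, `|C| ≤ m`, `Σ|u − v| ≤ δ`, `m·Σ|u| ≤ 1/3`,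
`m·Σ|v| ≤ 1/3` ⟹ a two-sided inverse `M′` of `1 − diag v·C` with `‖Y − C·M′‖ ≤ R + (9/4)m²δ` on `B²`. -/
theorem kltc_repin_on (B : Finset S) (C Y M : Matrix S S ℂ) (u v : S → ℝ) (R : S → S → ℝ) {m δ : ℝ} (hm : 0 ≤ m)
    (hC : ∀ s t, ‖C s t‖ ≤ m) (hM : (1 - diagonal (fun p => (u p : ℂ)) * C) * M = 1)
    (hR : ∀ k ∈ B, ∀ k' ∈ B, ‖Y k k' - (C * M) k k'‖ ≤ R k k') (hδ : ∑ p, |u p - v p| ≤ δ)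
    (hsu : m * ∑ p, |u p| ≤ 1 / 3) (hsv : m * ∑ p, |v p| ≤ 1 / 3) :
    ∃ M' : Matrix S S ℂ, (1 - diagonal (fun p => (v p : ℂ)) * C) * M' = 1 ∧ M' * (1 - diagonal (fun p => (v p : ℂ)) * C) = 1 ∧
      ∀ k ∈ B, ∀ k' ∈ B, ‖Y k k' - (C * M') k k'‖ ≤ R k k' + 9 / 4 * m ^ 2 * δ := by
  -- the two weight vectors in the `1 + diag z·C` convention
  set z₁ : S → ℂ := fun p => -(u p : ℂ) with hz₁
  set z₂ : S → ℂ := fun p => -(v p : ℂ) with hz₂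
  have hz₁n : ∀ p, ‖z₁ p‖ = |u p| := fun p => by rw [hz₁, norm_neg, Complex.norm_real, Real.norm_eq_abs]
  have hz₂n : ∀ p, ‖z₂ p‖ = |v p| := fun p => by rw [hz₂, norm_neg, Complex.norm_real, Real.norm_eq_abs]
  have hθ₁ : m * ∑ p, ‖z₁ p‖ ≤ 1 / 3 := by simp_rw [hz₁n]; exact hsu
  have hθ₂ : m * ∑ p, ‖z₂ p‖ ≤ 1 / 3 := by simp_rw [hz₂n]; exact hsv
  have hd₁ : diagonal z₁ = -diagonal (fun p => (u p : ℂ)) := (diagonal_neg _).symm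
  have hd₂ : diagonal z₂ = -diagonal (fun p => (v p : ℂ)) := (diagonal_neg _).symm
  -- Neumann inverses for both weights
  obtain ⟨N₁, A₁, hN₁1, hN₁2, -, hA₁2, hCN₁, hA₁n, -, -, -, -⟩ := klcrs_single_slice z₁ hm C hC hθ₁
  obtain ⟨N₂, A₂, hN₂1, hN₂2, hA₂1, -, hCN₂, hA₂n, -, -, -, -⟩ := klcrs_single_slice z₂ hm C hC hθ₂
  -- the given right inverse is `N₁`
  have hM' : (1 + diagonal z₁ * C) * M = 1 := by rw [hd₁, neg_mul, ← sub_eq_add_neg]; exact hM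
  have hMN : M = N₁ := by
    calc M = (N₁ * (1 + diagonal z₁ * C)) * M := by rw [hN₁2, one_mul]
      _ = N₁ := by rw [mul_assoc, hM', mul_one]
  -- weight perturbation between the two resummed arrays
  have hpert : ∀ s t, ‖(C * N₁ - C * N₂) s t‖ ≤ 9 / 4 * m ^ 2 * δ := by
    intro s t
    have h := klcrs_weight_perturbation z₁ z₂ hm C hC A₁ A₂ hA₁2 hA₂1 hA₁n hA₂n s t
    rw [hCN₁, hCN₂]
    refine h.trans (mul_le_mul_of_nonneg_left ?_ (by positivity))
    calc ∑ p, ‖z₁ p - z₂ p‖ = ∑ p, |u p - v p| := by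
          refine sum_congr rfl fun p _ => ?_
          show ‖-(u p : ℂ) - -(v p : ℂ)‖ = |u p - v p|
          rw [neg_sub_neg, ← Complex.ofReal_sub, Complex.norm_real, Real.norm_eq_abs, abs_sub_comm]
      _ ≤ δ := hδ
  rw [hd₂, neg_mul, ← sub_eq_add_neg] at hN₂1 hN₂2
  refine ⟨N₂, hN₂1, hN₂2, fun k hk k' hk' => ?_⟩
  · calc ‖Y k k' - (C * N₂) k k'‖ = ‖(Y k k' - (C * M) k k') + (C * N₁ - C * N₂) k k'‖ := by
          rw [hMN, Matrix.sub_apply, sub_add_sub_cancel]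
      _ ≤ ‖Y k k' - (C * M) k k'‖ + ‖(C * N₁ - C * N₂) k k'‖ := norm_add_le _ _
      _ ≤ R k k' + 9 / 4 * m ^ 2 * δ := add_le_add (hR k hk k' hk') (hpert k k')

/-- **The fourth side of the square, re-pinned.**  `kltc_transfer_compose_fwd_on` (p540411) followed by `kltc_repin_on`: the member relation at the new scale
with ANY target weight `t` such that `Σ|t − (b′ + w − w₁)| ≤ δ` (`m·Σ|t| ≤ 1/3`, `m·Σ|b′ + w − w₁| ≤ 1/3`), defect `E_a + FT_{|w₁|}(E₁) + (9/4)m²δ` on `B²`. -/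
theorem kltc_transfer_compose_fwd_on_repin (B : Finset S) (C₀ C₁ X Y N₀ M' N : Matrix S S ℂ) (w b' w₁ t : S → ℝ) (E R' Ea E₁ : S → S → ℝ)
    {m e e₁ δ : ℝ} (hm : 0 ≤ m) (he : 0 ≤ e) (he₁ : 0 ≤ e₁) (hC₁ : ∀ s t, ‖C₁ s t‖ ≤ m)
    (hC₀0 : ∀ x y, ¬(x ∈ B ∧ y ∈ B) → C₀ x y = 0) (hC₁0 : ∀ x y, ¬(x ∈ B ∧ y ∈ B) → C₁ x y = 0)
    (hX0 : ∀ x y, ¬(x ∈ B ∧ y ∈ B) → X x y = 0) (hY0 : ∀ x y, ¬(x ∈ B ∧ y ∈ B) → Y x y = 0)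
    (hE0 : ∀ x y, 0 ≤ E x y) (hR'0 : ∀ x y, 0 ≤ R' x y) (hEa0 : ∀ x y, 0 ≤ Ea x y)
    (hN₀ : (1 + diagonal (fun p => (w p : ℂ)) * C₀) * N₀ = 1)
    (hE : ∀ k ∈ B, ∀ k' ∈ B, ‖C₁ k k' - (C₀ * N₀) k k'‖ ≤ E k k') (hEe : ∀ x y, E x y ≤ e)
    (hM' : (1 - diagonal (fun p => (b' p : ℂ)) * C₀) * M' = 1)
    (hR' : ∀ k ∈ B, ∀ k' ∈ B, ‖X k k' - (C₀ * M') k k'‖ ≤ R' k k')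
    (hN : (1 + diagonal (fun p => (w₁ p : ℂ)) * X) * N = 1)
    (hEa : ∀ k ∈ B, ∀ k' ∈ B, ‖Y k k' - (X * N) k k'‖ ≤ Ea k k')
    (hE₁ : ∀ x y, R' x y + (E x y + 3 / 2 * m * ∑ t, E x t * |w t + b' t| + 3 / 2 * (m + e) * ∑ a, |w a + b' a| * E a y +
        9 / 4 * (m + e) * m * ∑ a, ∑ t, |w a + b' a| * E a t * |w t + b' t|) ≤ E₁ x y)
    (hE₁e : ∀ x y, E₁ x y ≤ e₁)
    (hsm₁ : (m + e) * ∑ a, |w a + b' a| ≤ 1 / 3) (hsm₂ : (3 / 2 * m + e₁) * ∑ a, |w₁ a| ≤ 1 / 3)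
    (hδ : ∑ p, |(b' p + w p - w₁ p) - t p| ≤ δ) (hsb : m * ∑ p, |b' p + w p - w₁ p| ≤ 1 / 3) (hst : m * ∑ p, |t p| ≤ 1 / 3) :
    ∃ M₀ : Matrix S S ℂ,
      (1 - diagonal (fun p => (t p : ℂ)) * C₁) * M₀ = 1 ∧ M₀ * (1 - diagonal (fun p => (t p : ℂ)) * C₁) = 1 ∧
      ∀ k ∈ B, ∀ k' ∈ B,
        ‖Y k k' - (C₁ * M₀) k k'‖ ≤
          Ea k k' + (E₁ k k' + 3 / 2 * (3 / 2 * m) * ∑ t, E₁ k t * |w₁ t| + 3 / 2 * (3 / 2 * m + e₁) * ∑ a, |w₁ a| * E₁ a k' +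
            9 / 4 * (3 / 2 * m + e₁) * (3 / 2 * m) * ∑ a, ∑ t, |w₁ a| * E₁ a t * |w₁ t|) + 9 / 4 * m ^ 2 * δ := by
  obtain ⟨M₁, h1, -, hbd⟩ := kltc_transfer_compose_fwd_on B C₀ C₁ X Y N₀ M' N w b' w₁ E R' Ea E₁ hm he he₁ hC₁ hC₀0 hC₁0 hX0 hY0 hE0 hR'0
    hEa0 hN₀ hE hEe hM' hR' hN hEa hE₁ hE₁e hsm₁ hsm₂
  exact kltc_repin_on B C₁ Y M₁ (fun p => b' p + w p - w₁ p) t _ hm hC₁ (by exact_mod_cast h1) hbd hδ hsb hst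

end Repin

end Summit.HubbardSuperconductivity.HubbardSuperconductivity.Theorems.KLRegimeSplit

end
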